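import Summits.HubbardSuperconductivity.HubbardSuperconductivity.Theorems.NodalWardXYPerturbedXYOrderMeanFieldBounds

/-!
# `PerturbedXYOrder` (stmt-HubbardSuperconductivity-10739) — line `schwarz-inheritance`, stub `stub_relTwistedSourceBound`

Tools (I) for the negative lemma N10′ of lead c19 — Goldstone pinching of the RELATIVELY BOUNDED invariant mean-field source
(`Theorems/PerturbedXYOrder/Negative/InvariantRelBoundedPinching.lean`).  The source is the Ward observable
`R(θ) = Σ_y Σ_b (cos(θ_{b₁} − θ_y) + cos(θ_{b₂} − θ_y))(1 − cos ∇_bθ)` (bond energies weighted by their alignment with the magnetisation);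
this file controls its symmetrised twist under a site-dependent rotation `g` POINTWISE:

* `gr_sin_twist_bond`, `gr_sum_abs_sin_twist_le` — `sin ∇_b g_k = sin(2πk/L)·[b ∥ e₀]` for the axial twists, `Σ_b |sin ∇_b g_k| ≤ 2πk L²`;
* `gr_twist_term`, `gr_twist_R_symm` — `½(R∘τ_g + R∘τ_{−g}) = T₁ + T₂ − T₃` with
  `T₁ = Σ (cosφ₁cosΔ₁ + cosφ₂cosΔ₂)(1 − cos a)`, `T₂ = Σ (…) cos a (1 − cos d)`, `T₃ = Σ (sinφ₁sinΔ₁ + sinφ₂sinΔ₂) sin a sin d`;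
* `gr_amgm`, `gr_weighted_sq_le`, `gr_pairing_le`, `gr_endpoint_le` — AM–GM for the current–magnetisation pairing:
  `Σ_b c_b Σ_y cos(θ_{pb} − θ_y)cos(g_{pb} − g_y) ≤ tE² + V(θ,g)/(2t)`, `E = Σ c_b`, `V = Σ_{x,y} cos(θ_x−θ_y)cos(g_x−g_y)`;
* `gr_twist_R_symm_le` = registered stub `stub_relTwistedSourceBound`:
  `½(R∘τ_g + R∘τ_{−g}) ≤ 2tE² + V/t + 2L³ Σ_b(1 − cos∇_b g) + 2L³ Σ_b|sin ∇_b g|` for every `t > 0`.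
-/

noncomputable section

namespace Summit.HubbardSuperconductivity.HubbardSuperconductivity.Theorems.PerturbedXYOrder

open MeasureTheory Literature.Probability.LatticeModels Metric Set
open Summit.HubbardSuperconductivity.HubbardSuperconductivity.Theses.NodalWardXY

variable {L : ℕ}

/-- Bond increments of the axial twist under `sin`: `sin ∇_b g_k = sin(2πk/L)` on direction-`0` bonds, `0` otherwise. -/
theorem gr_sin_twist_bond [NeZero L] (hL : 2 ≤ L) (k : ℕ) (x : TorusSite 3 L) (i : Fin 3) :
    Real.sin (2 * Real.pi * k * (((x + Pi.single i 1 : TorusSite 3 L) 0).val : ℝ) / L - 2 * Real.pi * k * ((x 0).val : ℝ) / L) =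
      if i = 0 then Real.sin (2 * Real.pi * k / L) else 0 := by
  have hL0 : (L : ℝ) ≠ 0 := by have := NeZero.ne L; exact_mod_cast this
  by_cases hi : i = 0
  · subst hi
    rw [if_pos rfl]
    haveI : Fact (1 < L) := ⟨hL⟩
    have hadd : (x + Pi.single (0 : Fin 3) (1 : ZMod L) : TorusSite 3 L) 0 = x 0 + 1 := by
      simp
    rw [hadd, ZMod.val_add, ZMod.val_one]
    have hlt : (x 0).val < L := ZMod.val_lt _
    rcases Nat.lt_or_ge ((x 0).val + 1) L with h | h
    · rw [Nat.mod_eq_of_lt h]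
      push_cast
      congr 1
      field_simp
      ring
    · have heq : (x 0).val + 1 = L := le_antisymm hlt h
      rw [heq, Nat.mod_self]
      push_cast
      have : 2 * Real.pi * k * (0 : ℝ) / L - 2 * Real.pi * k * ((x 0).val : ℝ) / L =
          2 * Real.pi * k / L - (k : ℕ) * (2 * Real.pi) := by
        have hv : ((x 0).val : ℝ) = L - 1 := by
          have : (((x 0).val + 1 : ℕ) : ℝ) = L := by exact_mod_cast heq
          push_cast at this; linarith
        rw [hv]
        field_simp
        ring
      rw [this, Real.sin_sub_nat_mul_two_pi]
  · rw [if_neg hi]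
    have hadd : (x + Pi.single i (1 : ZMod L) : TorusSite 3 L) 0 = x 0 := by
      rw [Pi.add_apply, Pi.single_eq_of_ne (fun h => hi h.symm), add_zero]
    rw [hadd, sub_self, Real.sin_zero]

/-- `Σ_b |sin ∇_b g_k| = L³ |sin(2πk/L)| ≤ 2πk L²`. -/
theorem gr_sum_abs_sin_twist_le [NeZero L] (hL : 2 ≤ L) (k : ℕ) :
    ∑ b : Bond L, |Real.sin (2 * Real.pi * k * (((b.1 + Pi.single b.2 1 : TorusSite 3 L) 0).val : ℝ) / L -
        2 * Real.pi * k * ((b.1 0).val : ℝ) / L)| ≤ 2 * Real.pi * k * (L : ℝ) ^ 2 := by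
  have hL0 : (0 : ℝ) < L := by have := NeZero.pos L; exact_mod_cast this
  rw [Fintype.sum_prod_type]
  simp only [gr_sin_twist_bond hL k, Finset.sum_const, Finset.card_univ, nsmul_eq_mul, cfp_card]
  have hinner : ∑ i : Fin 3, |(if i = 0 then Real.sin (2 * Real.pi * k / L) else 0)| =
      |Real.sin (2 * Real.pi * k / L)| := by
    rw [Fin.sum_univ_three]; simp
  rw [hinner]
  have h1 : |Real.sin (2 * Real.pi * k / L)| ≤ 2 * Real.pi * k / L := by
    refine (Real.abs_sin_le_abs).trans (le_of_eq (abs_of_nonneg (by positivity)))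
  calc (L : ℝ) ^ 3 * |Real.sin (2 * Real.pi * k / L)| ≤ (L : ℝ) ^ 3 * (2 * Real.pi * k / L) :=
        mul_le_mul_of_nonneg_left h1 (by positivity)
    _ = 2 * Real.pi * k * (L : ℝ) ^ 2 := by field_simp

/-- Per-term trigonometric identity behind the symmetrised twist of the energy-weighted source. -/
theorem gr_twist_term (θ₁ θ₂ θy g₁ g₂ gy : ℝ) :
    ((Real.cos ((θ₁ + g₁) - (θy + gy)) + Real.cos ((θ₂ + g₂) - (θy + gy))) * (1 - Real.cos ((θ₂ + g₂) - (θ₁ + g₁))) +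
      (Real.cos ((θ₁ - g₁) - (θy - gy)) + Real.cos ((θ₂ - g₂) - (θy - gy))) * (1 - Real.cos ((θ₂ - g₂) - (θ₁ - g₁)))) / 2 =
      (Real.cos (θ₁ - θy) * Real.cos (g₁ - gy) + Real.cos (θ₂ - θy) * Real.cos (g₂ - gy)) * (1 - Real.cos (θ₂ - θ₁)) +
      (Real.cos (θ₁ - θy) * Real.cos (g₁ - gy) + Real.cos (θ₂ - θy) * Real.cos (g₂ - gy)) *
        (Real.cos (θ₂ - θ₁) * (1 - Real.cos (g₂ - g₁))) -
      (Real.sin (θ₁ - θy) * Real.sin (g₁ - gy) + Real.sin (θ₂ - θy) * Real.sin (g₂ - gy)) *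
        (Real.sin (θ₂ - θ₁) * Real.sin (g₂ - g₁)) := by
  have e1 : (θ₁ + g₁) - (θy + gy) = (θ₁ - θy) + (g₁ - gy) := by ring
  have e2 : (θ₂ + g₂) - (θy + gy) = (θ₂ - θy) + (g₂ - gy) := by ring
  have e3 : (θ₂ + g₂) - (θ₁ + g₁) = (θ₂ - θ₁) + (g₂ - g₁) := by ring
  have e4 : (θ₁ - g₁) - (θy - gy) = (θ₁ - θy) - (g₁ - gy) := by ring
  have e5 : (θ₂ - g₂) - (θy - gy) = (θ₂ - θy) - (g₂ - gy) := by ring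
  have e6 : (θ₂ - g₂) - (θ₁ - g₁) = (θ₂ - θ₁) - (g₂ - g₁) := by ring
  rw [e1, e2, e3, e4, e5, e6, Real.cos_add (θ₁ - θy), Real.cos_add (θ₂ - θy), Real.cos_add (θ₂ - θ₁),
    Real.cos_sub (θ₁ - θy), Real.cos_sub (θ₂ - θy), Real.cos_sub (θ₂ - θ₁)]
  ring

/-- **AM–GM for the twisted current–magnetisation pairing**: for non-negative bond weights `c_b` with `Σ_b c_b = E`, a site map `p`, any
phase fields and `t > 0`,
`Σ_b c_b Σ_y cos(θ_{p b} − θ_y ± …)` is controlled by `t E² + (P² + Q²)/t`-type bounds; packaged form: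
`2 (A P + B Q) ≤ t (A² + B²) + (P² + Q²)/t`. -/
theorem gr_amgm {A B P Q t : ℝ} (ht : 0 < t) : 2 * (A * P + B * Q) ≤ t * (A ^ 2 + B ^ 2) + (P ^ 2 + Q ^ 2) / t := by
  have h1 : 0 ≤ (t * A - P) ^ 2 / t + (t * B - Q) ^ 2 / t := by positivity
  have h2 : t * (A ^ 2 + B ^ 2) + (P ^ 2 + Q ^ 2) / t - 2 * (A * P + B * Q) =
      (t * A - P) ^ 2 / t + (t * B - Q) ^ 2 / t := by
    field_simp; ring
  linarith

/-- A weighted sum of cosines (or sines) with non-negative weights is bounded by the total weight. -/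
theorem gr_weighted_sq_le [NeZero L] {c : Bond L → ℝ} (hc : ∀ b, 0 ≤ c b) (f : Bond L → ℝ) (hf : ∀ b, |f b| ≤ 1) :
    (∑ b : Bond L, c b * f b) ^ 2 ≤ (∑ b : Bond L, c b) ^ 2 := by
  have h1 : |∑ b : Bond L, c b * f b| ≤ ∑ b : Bond L, c b := by
    refine (Finset.abs_sum_le_sum_abs _ _).trans (Finset.sum_le_sum fun b _ => ?_)
    rw [abs_mul, abs_of_nonneg (hc b)]
    exact mul_le_of_le_one_right (hc b) (hf b)
  have h0 : 0 ≤ ∑ b : Bond L, c b := Finset.sum_nonneg fun b _ => hc b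
  rw [← sq_abs (∑ b : Bond L, c b * f b)]
  exact pow_le_pow_left₀ (abs_nonneg _) h1 2

/-- **The pairing bound**: for non-negative bond weights `c` with total `E = Σ_b c_b`, a site map `p : Bond → Λ`, phase fields `θ, g`
and `t > 0`,
`Σ_b c_b Σ_y cos((θ_{p b} + g_{p b}) − (θ_y + g_y)) ≤ (t E² + (Σ_{y,y'} cos((θ_y + g_y) − (θ_{y'} + g_{y'})))/t) / 2 … `; precisely
`2 Σ_b c_b Σ_y cos(ψ_{p b} − ψ_y) ≤ 2 t E² + (Σ_{y,y'} cos(ψ_y − ψ_{y'}))/t` for any phase field `ψ`. -/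
theorem gr_pairing_le [NeZero L] {c : Bond L → ℝ} (hc : ∀ b, 0 ≤ c b) (p : Bond L → TorusSite 3 L) (ψ : TorusSite 3 L → ℝ)
    {t : ℝ} (ht : 0 < t) :
    2 * ∑ b : Bond L, c b * ∑ y : TorusSite 3 L, Real.cos (ψ (p b) - ψ y) ≤
      2 * t * (∑ b : Bond L, c b) ^ 2 + (∑ y : TorusSite 3 L, ∑ y' : TorusSite 3 L, Real.cos (ψ y - ψ y')) / t := by
  set A : ℝ := ∑ b : Bond L, c b * Real.cos (ψ (p b)) with hA
  set B : ℝ := ∑ b : Bond L, c b * Real.sin (ψ (p b)) with hB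
  set P : ℝ := ∑ y : TorusSite 3 L, Real.cos (ψ y) with hP
  set Q : ℝ := ∑ y : TorusSite 3 L, Real.sin (ψ y) with hQ
  have hsum : ∑ b : Bond L, c b * ∑ y : TorusSite 3 L, Real.cos (ψ (p b) - ψ y) = A * P + B * Q := by
    have hb : ∀ b : Bond L, ∑ y : TorusSite 3 L, Real.cos (ψ (p b) - ψ y) =
        Real.cos (ψ (p b)) * P + Real.sin (ψ (p b)) * Q := by
      intro b
      simp_rw [Real.cos_sub]
      rw [Finset.sum_add_distrib, hP, hQ, Finset.mul_sum, Finset.mul_sum]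
    simp_rw [hb]
    rw [hA, hB, Finset.sum_mul, Finset.sum_mul, ← Finset.sum_add_distrib]
    refine Finset.sum_congr rfl fun b _ => ?_
    ring
  have hS : ∑ y : TorusSite 3 L, ∑ y' : TorusSite 3 L, Real.cos (ψ y - ψ y') = P ^ 2 + Q ^ 2 := cfp_sum_cos_sub ψ
  have hA2 : A ^ 2 ≤ (∑ b : Bond L, c b) ^ 2 := gr_weighted_sq_le hc _ fun b => Real.abs_cos_le_one _
  have hB2 : B ^ 2 ≤ (∑ b : Bond L, c b) ^ 2 := gr_weighted_sq_le hc _ fun b => Real.abs_sin_le_one _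
  have ham := gr_amgm (A := A) (B := B) (P := P) (Q := Q) ht
  rw [hsum, hS]
  have : t * (A ^ 2 + B ^ 2) ≤ 2 * t * (∑ b : Bond L, c b) ^ 2 := by nlinarith
  linarith

/-- **Symmetrised twist of the energy-weighted source** `R(θ) = Σ_y Σ_b (cos(θ_{b₁} − θ_y) + cos(θ_{b₂} − θ_y))(1 − cos ∇_bθ)`:
`½(R(θ+g) + R(θ−g)) = Σ_y Σ_b [(cosφ₁cosΔ₁ + cosφ₂cosΔ₂)(1 − cos a) + (cosφ₁cosΔ₁ + cosφ₂cosΔ₂) cos a (1 − cos d) − (sinφ₁sinΔ₁ + sinφ₂sinΔ₂) sin a sin d]`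
(`a = ∇_bθ`, `d = ∇_b g`, `φ_i = θ_{b_i} − θ_y`, `Δ_i = g_{b_i} − g_y`). -/
theorem gr_twist_R_symm [NeZero L] (θ g : TorusSite 3 L → ℝ) :
    ((∑ y : TorusSite 3 L, ∑ b : Bond L,
        (Real.cos ((θ b.1 + g b.1) - (θ y + g y)) + Real.cos ((θ (b.1 + Pi.single b.2 1) + g (b.1 + Pi.single b.2 1)) - (θ y + g y))) *
          (1 - Real.cos ((θ (b.1 + Pi.single b.2 1) + g (b.1 + Pi.single b.2 1)) - (θ b.1 + g b.1)))) +
      ∑ y : TorusSite 3 L, ∑ b : Bond L,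
        (Real.cos ((θ b.1 - g b.1) - (θ y - g y)) + Real.cos ((θ (b.1 + Pi.single b.2 1) - g (b.1 + Pi.single b.2 1)) - (θ y - g y))) *
          (1 - Real.cos ((θ (b.1 + Pi.single b.2 1) - g (b.1 + Pi.single b.2 1)) - (θ b.1 - g b.1)))) / 2 =
      ∑ y : TorusSite 3 L, ∑ b : Bond L,
        ((Real.cos (θ b.1 - θ y) * Real.cos (g b.1 - g y) +
            Real.cos (θ (b.1 + Pi.single b.2 1) - θ y) * Real.cos (g (b.1 + Pi.single b.2 1) - g y)) *
            (1 - Real.cos (θ (b.1 + Pi.single b.2 1) - θ b.1)) +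
          (Real.cos (θ b.1 - θ y) * Real.cos (g b.1 - g y) +
            Real.cos (θ (b.1 + Pi.single b.2 1) - θ y) * Real.cos (g (b.1 + Pi.single b.2 1) - g y)) *
            (Real.cos (θ (b.1 + Pi.single b.2 1) - θ b.1) * (1 - Real.cos (g (b.1 + Pi.single b.2 1) - g b.1))) -
          (Real.sin (θ b.1 - θ y) * Real.sin (g b.1 - g y) +
            Real.sin (θ (b.1 + Pi.single b.2 1) - θ y) * Real.sin (g (b.1 + Pi.single b.2 1) - g y)) *
            (Real.sin (θ (b.1 + Pi.single b.2 1) - θ b.1) * Real.sin (g (b.1 + Pi.single b.2 1) - g b.1))) := by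
  rw [← Finset.sum_add_distrib, Finset.sum_div]
  refine Finset.sum_congr rfl fun y _ => ?_
  rw [← Finset.sum_add_distrib, Finset.sum_div]
  refine Finset.sum_congr rfl fun b _ => ?_
  exact gr_twist_term (θ b.1) (θ (b.1 + Pi.single b.2 1)) (θ y) (g b.1) (g (b.1 + Pi.single b.2 1)) (g y)

/-- One endpoint of the main twisted term: for non-negative bond weights `c` and a site map `p`,
`Σ_b c_b Σ_y cos(θ_{p b} − θ_y) cos(g_{p b} − g_y) ≤ t E² + V(θ,g)/(2t)`, `E = Σ c_b`, `V = Σ_{x,y} cos(θ_x − θ_y) cos(g_x − g_y)`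
(write `cos φ cos Δ = ½(cos(φ+Δ) + cos(φ−Δ))`, apply `gr_pairing_le` to the phase fields `θ ± g`, and `gp_sum_cos_twist_add`). -/
theorem gr_endpoint_le [NeZero L] {c : Bond L → ℝ} (hc : ∀ b, 0 ≤ c b) (p : Bond L → TorusSite 3 L) (θ g : TorusSite 3 L → ℝ)
    {t : ℝ} (ht : 0 < t) :
    ∑ b : Bond L, c b * ∑ y : TorusSite 3 L, Real.cos (θ (p b) - θ y) * Real.cos (g (p b) - g y) ≤
      t * (∑ b : Bond L, c b) ^ 2 +
        (∑ x : TorusSite 3 L, ∑ y : TorusSite 3 L, Real.cos (θ x - θ y) * Real.cos (g x - g y)) / (2 * t) := by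
  have hp := gr_pairing_le hc p (fun v => θ v + g v) ht
  have hm := gr_pairing_le hc p (fun v => θ v - g v) ht
  have hV := gp_sum_cos_twist_add θ g
  have hsplit : ∑ b : Bond L, c b * ∑ y : TorusSite 3 L, Real.cos (θ (p b) - θ y) * Real.cos (g (p b) - g y) =
      ((∑ b : Bond L, c b * ∑ y : TorusSite 3 L, Real.cos ((θ (p b) + g (p b)) - (θ y + g y))) +
        ∑ b : Bond L, c b * ∑ y : TorusSite 3 L, Real.cos ((θ (p b) - g (p b)) - (θ y - g y))) / 2 := by
    rw [← Finset.sum_add_distrib, Finset.sum_div]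
    refine Finset.sum_congr rfl fun b _ => ?_
    rw [← mul_add, ← Finset.sum_add_distrib, mul_div_assoc, Finset.sum_div]
    congr 1
    refine Finset.sum_congr rfl fun y _ => ?_
    have e1 : (θ (p b) + g (p b)) - (θ y + g y) = (θ (p b) - θ y) + (g (p b) - g y) := by ring
    have e2 : (θ (p b) - g (p b)) - (θ y - g y) = (θ (p b) - θ y) - (g (p b) - g y) := by ring
    rw [e1, e2, Real.cos_add (θ (p b) - θ y) (g (p b) - g y), Real.cos_sub (θ (p b) - θ y) (g (p b) - g y)]
    ring
  rw [hsplit]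
  rw [div_le_iff₀ (by norm_num : (0 : ℝ) < 2)]
  have e3 : (t * (∑ b : Bond L, c b) ^ 2 +
      (∑ x : TorusSite 3 L, ∑ y : TorusSite 3 L, Real.cos (θ x - θ y) * Real.cos (g x - g y)) / (2 * t)) * 2 =
      2 * t * (∑ b : Bond L, c b) ^ 2 +
        ((∑ x : TorusSite 3 L, ∑ y : TorusSite 3 L, Real.cos ((θ x + g x) - (θ y + g y))) +
          ∑ x : TorusSite 3 L, ∑ y : TorusSite 3 L, Real.cos ((θ x - g x) - (θ y - g y))) / t / 2 := by
    rw [hV]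
    field_simp
  rw [e3]
  have ht2 : ((∑ x : TorusSite 3 L, ∑ y : TorusSite 3 L, Real.cos ((θ x + g x) - (θ y + g y))) +
      ∑ x : TorusSite 3 L, ∑ y : TorusSite 3 L, Real.cos ((θ x - g x) - (θ y - g y))) / t / 2 =
      ((∑ x : TorusSite 3 L, ∑ y : TorusSite 3 L, Real.cos ((θ x + g x) - (θ y + g y))) / t +
        (∑ x : TorusSite 3 L, ∑ y : TorusSite 3 L, Real.cos ((θ x - g x) - (θ y - g y))) / t) / 2 := by ring
  rw [ht2]
  linarith

/-- **Pointwise bound on the symmetrised twisted source.** For every `θ`, every twist `g` and `t > 0`,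
`½(R(θ+g) + R(θ−g)) ≤ 2tE² + V(θ,g)/t + 2L³ Σ_b(1 − cos ∇_b g) + 2L³ Σ_b |sin ∇_b g|`, `E = Σ_b (1 − cos ∇_bθ)`. -/
theorem gr_twist_R_symm_le [NeZero L] (θ g : TorusSite 3 L → ℝ) {t : ℝ} (ht : 0 < t) :
    ((∑ y : TorusSite 3 L, ∑ b : Bond L,
        (Real.cos ((θ b.1 + g b.1) - (θ y + g y)) + Real.cos ((θ (b.1 + Pi.single b.2 1) + g (b.1 + Pi.single b.2 1)) - (θ y + g y))) *
          (1 - Real.cos ((θ (b.1 + Pi.single b.2 1) + g (b.1 + Pi.single b.2 1)) - (θ b.1 + g b.1)))) +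
      ∑ y : TorusSite 3 L, ∑ b : Bond L,
        (Real.cos ((θ b.1 - g b.1) - (θ y - g y)) + Real.cos ((θ (b.1 + Pi.single b.2 1) - g (b.1 + Pi.single b.2 1)) - (θ y - g y))) *
          (1 - Real.cos ((θ (b.1 + Pi.single b.2 1) - g (b.1 + Pi.single b.2 1)) - (θ b.1 - g b.1)))) / 2 ≤
      2 * t * (∑ b : Bond L, (1 - Real.cos (θ (b.1 + Pi.single b.2 1) - θ b.1))) ^ 2 +
        (∑ x : TorusSite 3 L, ∑ y : TorusSite 3 L, Real.cos (θ x - θ y) * Real.cos (g x - g y)) / t +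
        (L : ℝ) ^ 3 * (2 * ∑ b : Bond L, (1 - Real.cos (g (b.1 + Pi.single b.2 1) - g b.1))) +
        (L : ℝ) ^ 3 * (2 * ∑ b : Bond L, |Real.sin (g (b.1 + Pi.single b.2 1) - g b.1)|) := by
  rw [gr_twist_R_symm θ g]
  have hsplit3 : ∑ y : TorusSite 3 L, ∑ b : Bond L,
        ((Real.cos (θ b.1 - θ y) * Real.cos (g b.1 - g y) +
            Real.cos (θ (b.1 + Pi.single b.2 1) - θ y) * Real.cos (g (b.1 + Pi.single b.2 1) - g y)) *
            (1 - Real.cos (θ (b.1 + Pi.single b.2 1) - θ b.1)) +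
          (Real.cos (θ b.1 - θ y) * Real.cos (g b.1 - g y) +
            Real.cos (θ (b.1 + Pi.single b.2 1) - θ y) * Real.cos (g (b.1 + Pi.single b.2 1) - g y)) *
            (Real.cos (θ (b.1 + Pi.single b.2 1) - θ b.1) * (1 - Real.cos (g (b.1 + Pi.single b.2 1) - g b.1))) -
          (Real.sin (θ b.1 - θ y) * Real.sin (g b.1 - g y) +
            Real.sin (θ (b.1 + Pi.single b.2 1) - θ y) * Real.sin (g (b.1 + Pi.single b.2 1) - g y)) *
            (Real.sin (θ (b.1 + Pi.single b.2 1) - θ b.1) * Real.sin (g (b.1 + Pi.single b.2 1) - g b.1))) =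
      (∑ y : TorusSite 3 L, ∑ b : Bond L,
        (Real.cos (θ b.1 - θ y) * Real.cos (g b.1 - g y) +
            Real.cos (θ (b.1 + Pi.single b.2 1) - θ y) * Real.cos (g (b.1 + Pi.single b.2 1) - g y)) *
            (1 - Real.cos (θ (b.1 + Pi.single b.2 1) - θ b.1))) +
      (∑ y : TorusSite 3 L, ∑ b : Bond L,
        (Real.cos (θ b.1 - θ y) * Real.cos (g b.1 - g y) +
            Real.cos (θ (b.1 + Pi.single b.2 1) - θ y) * Real.cos (g (b.1 + Pi.single b.2 1) - g y)) *
            (Real.cos (θ (b.1 + Pi.single b.2 1) - θ b.1) * (1 - Real.cos (g (b.1 + Pi.single b.2 1) - g b.1)))) -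
      (∑ y : TorusSite 3 L, ∑ b : Bond L,
        (Real.sin (θ b.1 - θ y) * Real.sin (g b.1 - g y) +
            Real.sin (θ (b.1 + Pi.single b.2 1) - θ y) * Real.sin (g (b.1 + Pi.single b.2 1) - g y)) *
            (Real.sin (θ (b.1 + Pi.single b.2 1) - θ b.1) * Real.sin (g (b.1 + Pi.single b.2 1) - g b.1))) := by
    rw [← Finset.sum_add_distrib, ← Finset.sum_sub_distrib]
    refine Finset.sum_congr rfl fun y _ => ?_
    rw [← Finset.sum_add_distrib, ← Finset.sum_sub_distrib]
  rw [hsplit3]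
  -- the three pieces
  set c : Bond L → ℝ := fun b => 1 - Real.cos (θ (b.1 + Pi.single b.2 1) - θ b.1) with hcdef
  have hc : ∀ b, 0 ≤ c b := fun b => by simp only [hcdef]; linarith [Real.cos_le_one (θ (b.1 + Pi.single b.2 1) - θ b.1)]
  -- T1
  have hT1 : ∑ y : TorusSite 3 L, ∑ b : Bond L,
      (Real.cos (θ b.1 - θ y) * Real.cos (g b.1 - g y) +
          Real.cos (θ (b.1 + Pi.single b.2 1) - θ y) * Real.cos (g (b.1 + Pi.single b.2 1) - g y)) *
        (1 - Real.cos (θ (b.1 + Pi.single b.2 1) - θ b.1)) ≤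
      2 * t * (∑ b : Bond L, (1 - Real.cos (θ (b.1 + Pi.single b.2 1) - θ b.1))) ^ 2 +
        (∑ x : TorusSite 3 L, ∑ y : TorusSite 3 L, Real.cos (θ x - θ y) * Real.cos (g x - g y)) / t := by
    have h1 := gr_endpoint_le hc (fun b => b.1) θ g ht
    have h2 := gr_endpoint_le hc (fun b => b.1 + Pi.single b.2 1) θ g ht
    simp only [hcdef] at h1 h2
    rw [Finset.sum_comm]
    have hsplit : ∑ b : Bond L, ∑ y : TorusSite 3 L,
        (Real.cos (θ b.1 - θ y) * Real.cos (g b.1 - g y) +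
            Real.cos (θ (b.1 + Pi.single b.2 1) - θ y) * Real.cos (g (b.1 + Pi.single b.2 1) - g y)) *
          (1 - Real.cos (θ (b.1 + Pi.single b.2 1) - θ b.1)) =
        (∑ b : Bond L, (1 - Real.cos (θ (b.1 + Pi.single b.2 1) - θ b.1)) *
          ∑ y : TorusSite 3 L, Real.cos (θ b.1 - θ y) * Real.cos (g b.1 - g y)) +
        ∑ b : Bond L, (1 - Real.cos (θ (b.1 + Pi.single b.2 1) - θ b.1)) *
          ∑ y : TorusSite 3 L, Real.cos (θ (b.1 + Pi.single b.2 1) - θ y) * Real.cos (g (b.1 + Pi.single b.2 1) - g y) := by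
      rw [← Finset.sum_add_distrib]
      refine Finset.sum_congr rfl fun b _ => ?_
      rw [Finset.mul_sum, Finset.mul_sum, ← Finset.sum_add_distrib]
      refine Finset.sum_congr rfl fun y _ => ?_
      ring
    rw [hsplit]
    have e : 2 * ((∑ x : TorusSite 3 L, ∑ y : TorusSite 3 L, Real.cos (θ x - θ y) * Real.cos (g x - g y)) / (2 * t)) =
        (∑ x : TorusSite 3 L, ∑ y : TorusSite 3 L, Real.cos (θ x - θ y) * Real.cos (g x - g y)) / t := by
      rw [mul_div_assoc']
      exact mul_div_mul_left _ t two_ne_zero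
    linarith
  -- T2
  have hT2 : ∑ y : TorusSite 3 L, ∑ b : Bond L,
      (Real.cos (θ b.1 - θ y) * Real.cos (g b.1 - g y) +
          Real.cos (θ (b.1 + Pi.single b.2 1) - θ y) * Real.cos (g (b.1 + Pi.single b.2 1) - g y)) *
        (Real.cos (θ (b.1 + Pi.single b.2 1) - θ b.1) * (1 - Real.cos (g (b.1 + Pi.single b.2 1) - g b.1))) ≤
      (L : ℝ) ^ 3 * (2 * ∑ b : Bond L, (1 - Real.cos (g (b.1 + Pi.single b.2 1) - g b.1))) := by
    calc _ ≤ ∑ _y : TorusSite 3 L, ∑ b : Bond L, 2 * (1 - Real.cos (g (b.1 + Pi.single b.2 1) - g b.1)) := by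
          refine Finset.sum_le_sum fun y _ => Finset.sum_le_sum fun b _ => ?_
          have hd : 0 ≤ 1 - Real.cos (g (b.1 + Pi.single b.2 1) - g b.1) := by linarith [Real.cos_le_one (g (b.1 + Pi.single b.2 1) - g b.1)]
          have hX : |(Real.cos (θ b.1 - θ y) * Real.cos (g b.1 - g y) +
              Real.cos (θ (b.1 + Pi.single b.2 1) - θ y) * Real.cos (g (b.1 + Pi.single b.2 1) - g y)) *
              Real.cos (θ (b.1 + Pi.single b.2 1) - θ b.1)| ≤ 2 := by
            rw [abs_mul]
            have h1 : |Real.cos (θ b.1 - θ y) * Real.cos (g b.1 - g y) +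
                Real.cos (θ (b.1 + Pi.single b.2 1) - θ y) * Real.cos (g (b.1 + Pi.single b.2 1) - g y)| ≤ 2 := by
              refine (abs_add_le _ _).trans ?_
              rw [abs_mul, abs_mul]
              nlinarith [Real.abs_cos_le_one (θ b.1 - θ y), Real.abs_cos_le_one (g b.1 - g y),
                Real.abs_cos_le_one (θ (b.1 + Pi.single b.2 1) - θ y), Real.abs_cos_le_one (g (b.1 + Pi.single b.2 1) - g y),
                abs_nonneg (Real.cos (θ b.1 - θ y)), abs_nonneg (Real.cos (g b.1 - g y)),
                abs_nonneg (Real.cos (θ (b.1 + Pi.single b.2 1) - θ y)), abs_nonneg (Real.cos (g (b.1 + Pi.single b.2 1) - g y))]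
            calc _ ≤ 2 * 1 := mul_le_mul h1 (Real.abs_cos_le_one _) (abs_nonneg _) (by norm_num)
              _ = 2 := by ring
          have := (le_abs_self _).trans hX
          calc _ = ((Real.cos (θ b.1 - θ y) * Real.cos (g b.1 - g y) +
                Real.cos (θ (b.1 + Pi.single b.2 1) - θ y) * Real.cos (g (b.1 + Pi.single b.2 1) - g y)) *
                Real.cos (θ (b.1 + Pi.single b.2 1) - θ b.1)) * (1 - Real.cos (g (b.1 + Pi.single b.2 1) - g b.1)) := by ring
            _ ≤ 2 * (1 - Real.cos (g (b.1 + Pi.single b.2 1) - g b.1)) := mul_le_mul_of_nonneg_right this hd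
      _ = (L : ℝ) ^ 3 * (2 * ∑ b : Bond L, (1 - Real.cos (g (b.1 + Pi.single b.2 1) - g b.1))) := by
          rw [Finset.sum_const, Finset.card_univ, nsmul_eq_mul, cfp_card, ← Finset.mul_sum]
  -- T3
  have hT3 : -(∑ y : TorusSite 3 L, ∑ b : Bond L,
      (Real.sin (θ b.1 - θ y) * Real.sin (g b.1 - g y) +
          Real.sin (θ (b.1 + Pi.single b.2 1) - θ y) * Real.sin (g (b.1 + Pi.single b.2 1) - g y)) *
        (Real.sin (θ (b.1 + Pi.single b.2 1) - θ b.1) * Real.sin (g (b.1 + Pi.single b.2 1) - g b.1))) ≤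
      (L : ℝ) ^ 3 * (2 * ∑ b : Bond L, |Real.sin (g (b.1 + Pi.single b.2 1) - g b.1)|) := by
    rw [← Finset.sum_neg_distrib]
    calc _ ≤ ∑ _y : TorusSite 3 L, ∑ b : Bond L, 2 * |Real.sin (g (b.1 + Pi.single b.2 1) - g b.1)| := by
          refine Finset.sum_le_sum fun y _ => ?_
          rw [← Finset.sum_neg_distrib]
          refine Finset.sum_le_sum fun b _ => ?_
          have hX : |(Real.sin (θ b.1 - θ y) * Real.sin (g b.1 - g y) +
              Real.sin (θ (b.1 + Pi.single b.2 1) - θ y) * Real.sin (g (b.1 + Pi.single b.2 1) - g y)) *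
              (Real.sin (θ (b.1 + Pi.single b.2 1) - θ b.1) * Real.sin (g (b.1 + Pi.single b.2 1) - g b.1))| ≤
              2 * |Real.sin (g (b.1 + Pi.single b.2 1) - g b.1)| := by
            rw [abs_mul, abs_mul]
            have h1 : |Real.sin (θ b.1 - θ y) * Real.sin (g b.1 - g y) +
                Real.sin (θ (b.1 + Pi.single b.2 1) - θ y) * Real.sin (g (b.1 + Pi.single b.2 1) - g y)| ≤ 2 := by
              refine (abs_add_le _ _).trans ?_
              rw [abs_mul, abs_mul]
              nlinarith [Real.abs_sin_le_one (θ b.1 - θ y), Real.abs_sin_le_one (g b.1 - g y),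
                Real.abs_sin_le_one (θ (b.1 + Pi.single b.2 1) - θ y), Real.abs_sin_le_one (g (b.1 + Pi.single b.2 1) - g y),
                abs_nonneg (Real.sin (θ b.1 - θ y)), abs_nonneg (Real.sin (g b.1 - g y)),
                abs_nonneg (Real.sin (θ (b.1 + Pi.single b.2 1) - θ y)), abs_nonneg (Real.sin (g (b.1 + Pi.single b.2 1) - g y))]
            have h2 : |Real.sin (θ (b.1 + Pi.single b.2 1) - θ b.1)| * |Real.sin (g (b.1 + Pi.single b.2 1) - g b.1)| ≤
                1 * |Real.sin (g (b.1 + Pi.single b.2 1) - g b.1)| :=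
              mul_le_mul_of_nonneg_right (Real.abs_sin_le_one _) (abs_nonneg _)
            calc _ ≤ 2 * (1 * |Real.sin (g (b.1 + Pi.single b.2 1) - g b.1)|) :=
                  mul_le_mul h1 h2 (by positivity) (by norm_num)
              _ = _ := by ring
          exact (neg_le_abs _).trans hX
      _ = (L : ℝ) ^ 3 * (2 * ∑ b : Bond L, |Real.sin (g (b.1 + Pi.single b.2 1) - g b.1)|) := by
          rw [Finset.sum_const, Finset.card_univ, nsmul_eq_mul, cfp_card, ← Finset.mul_sum]
  linarith

/-- STUB `stub_relTwistedSourceBound` (registered on stmt-HubbardSuperconductivity-10739, line `schwarz-inheritance`, lead c19, rev 20): the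
**pointwise bound on the symmetrised twisted energy-weighted source** `½(R(θ+g) + R(θ−g)) ≤ 2tE² + V(θ,g)/t + 2L³Σ_b(1 − cos∇_bg) + 2L³Σ_b|sin∇_bg|`
(= `gr_twist_R_symm_le`). [folklore] -/
theorem stub_relTwistedSourceBound : ∀ (L : ℕ) [NeZero L] (θ g : TorusSite 3 L → ℝ) (t : ℝ), 0 < t →
    ((∑ y : TorusSite 3 L, ∑ b : Bond L,
        (Real.cos ((θ b.1 + g b.1) - (θ y + g y)) + Real.cos ((θ (b.1 + Pi.single b.2 1) + g (b.1 + Pi.single b.2 1)) - (θ y + g y))) *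
          (1 - Real.cos ((θ (b.1 + Pi.single b.2 1) + g (b.1 + Pi.single b.2 1)) - (θ b.1 + g b.1)))) +
      ∑ y : TorusSite 3 L, ∑ b : Bond L,
        (Real.cos ((θ b.1 - g b.1) - (θ y - g y)) + Real.cos ((θ (b.1 + Pi.single b.2 1) - g (b.1 + Pi.single b.2 1)) - (θ y - g y))) *
          (1 - Real.cos ((θ (b.1 + Pi.single b.2 1) - g (b.1 + Pi.single b.2 1)) - (θ b.1 - g b.1)))) / 2 ≤
      2 * t * (∑ b : Bond L, (1 - Real.cos (θ (b.1 + Pi.single b.2 1) - θ b.1))) ^ 2 +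
        (∑ x : TorusSite 3 L, ∑ y : TorusSite 3 L, Real.cos (θ x - θ y) * Real.cos (g x - g y)) / t +
        (L : ℝ) ^ 3 * (2 * ∑ b : Bond L, (1 - Real.cos (g (b.1 + Pi.single b.2 1) - g b.1))) +
        (L : ℝ) ^ 3 * (2 * ∑ b : Bond L, |Real.sin (g (b.1 + Pi.single b.2 1) - g b.1)|) :=
  fun _L _ θ g _t ht => gr_twist_R_symm_le θ g ht

end Summit.HubbardSuperconductivity.HubbardSuperconductivity.Theorems.PerturbedXYOrder

end
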